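import Summits.ResolutionOfSingularities.ResolutionOfSingularities.Theorems.HilbertSamuelEliminationSigmaMaxModificationsCorridor3WLadderIsoRestartComponents
import Literature.AlgebraicGeometry.Resolution.CanonicalEliminationSequence
import HarnessLib

/-!
# [OURS · L1 W4.2] D8-S1 infrastructure, file 2: the DOMINANCE TEST of `Labelling.next` commutes with open restriction, and the
# LABEL ORDER RELATION `LabelRel` between a stage and its pointed open (crux chain w42, v7 stub `stub_isoOpenRestartLocal` ⟸
# `LocalRunSimulationM p`; hand res-D-pv-060)

OURS plumbing (cell `res-hironaka`, slot W4.2, crux `stmt-ResolutionOfSingularities-18506` / conjunct `-19249`; `--supports … --as helper`,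
counted 0); pure topology; NOT statements of the manuscript under review [claim: Hironaka2017, status: under-review] nor of
[CossartJannsenSaito2020]. AI plumbing, weaker than expert review.

`Labelling.next` (tree `CanonicalEliminationSequence`) gives a component `Z` of the new stratum the label of the component `closure (π '' Z)`
of the old stratum when that closure IS a component («`Z` dominates»), else the new year. Along the open immersions `ι` of the
run-level Zariski localisation (D8-S1 DESIGN §2, §4) this test must give the same answer upstairs (global run) and on the pointed open
(restricted run). The two topological facts:
* `closure_image_inter_preimage_of_isPreirreducible` — for `π` continuous, `Ω` open and `Z` preirreducible meeting `π ⁻¹' Ω`: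
  `closure (π '' (Z ∩ π ⁻¹' Ω)) = closure (π '' Z)` (a non-empty open part of an irreducible set is dense in it);
* `mem_componentsIn_of_preimage_mem` — for an open embedding `f`, a CLOSED irreducible `E ⊆ S` meeting the range with
  `f ⁻¹' E ∈ componentsIn (f ⁻¹' S)` is itself a component of `S` (converse of file 1's `preimage_mem_componentsIn_of_isOpenEmbedding`
  for closed irreducible candidates such as `closure (π '' Z)`);
* `image_preimage_eq_preimage_image_of_range_eq`, `closure_image_preimage_eq_preimage_closure_image`,
  `closure_image_preimage_mem_componentsIn_iff` — for a square of maps `πβ ∘ f' = f ∘ πα` with `f` an open embedding and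
  `range f' = πβ ⁻¹' (range f)` (a blow-up restricted over an open): `closure (πα '' (f' ⁻¹' Z')) = f ⁻¹' closure (πβ '' Z')`, and for
  `Y` closed and `Z'` preirreducible meeting `range f'` the dominance tests agree:
  `closure (πα '' (f' ⁻¹' Z')) ∈ componentsIn (f ⁻¹' Y) ↔ closure (πβ '' Z') ∈ componentsIn Y`;
* `exists_eq_closure_image_of_comp_eq` — the IDLE case (`πβ ∘ f' = f`, no blow-up on the open): a component `Z'` of `Y'` meeting
  `range f'` with `f' ⁻¹' Y' = f ⁻¹' Y` dominates the component `Z` of `Y` with `f ⁻¹' Z = f' ⁻¹' Z'`.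
§B (namespace `…Cruxes.SigmaMaxModifications.IdeasL1Idea2R4`, next to `LocalRunSimulationM`): the relation
`LabelRel ι Y L L'` — «on the components of `Y` meeting the range of `ι` the label ORDER of `L` is the label order of `L'` on their
traces» (only order and equality of labels are read by `IsCanonicalStep`: least non-empty label, parts) — with: equality version,
the trivial start (`of_forall_eq`: one component meets the open — the pointed restart), parts (`preimage_part_eq`), least non-empty
label (`isLeast`), and its propagation through `Labelling.next` on both sides (`next_next`, genuine step on the open) and on the big
side only (`next_left`, idle step on the open), given labels `≤` year on both sides (tree `CycleInv.label_le_year`).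
[folklore]
-/

set_option linter.dupNamespace false -- mandated namespace of this single-conjunct summit

open Topology TopologicalSpace Set

universe u v

namespace Summit.ResolutionOfSingularities.ResolutionOfSingularities.Theorems.CampaignW42

open Literature.AlgebraicGeometry.Resolution

variable {X : Type u} {Y : Type v} [TopologicalSpace X] [TopologicalSpace Y]

/-- **A non-empty open part of a preirreducible set has the same closure of image**: for `π` continuous, `Ω` open and `Z`
preirreducible with `Z ∩ π ⁻¹' Ω ≠ ∅`, `closure (π '' (Z ∩ π ⁻¹' Ω)) = closure (π '' Z)`. [folklore] -/
theorem closure_image_inter_preimage_of_isPreirreducible {π : X → Y} (hπ : Continuous π) {Ω : Set Y} (hΩ : IsOpen Ω)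
    {Z : Set X} (hZ : IsPreirreducible Z) (hne : (Z ∩ π ⁻¹' Ω).Nonempty) :
    closure (π '' (Z ∩ π ⁻¹' Ω)) = closure (π '' Z) := by
  refine Subset.antisymm (closure_mono (image_mono inter_subset_left)) ?_
  -- `Z ⊆ closure (Z ∩ π⁻¹ Ω)` (dense open part), hence `π '' Z ⊆ closure (π '' (Z ∩ π⁻¹ Ω))`
  have hdense : Z ⊆ closure (Z ∩ π ⁻¹' Ω) :=
    subset_closure_inter_of_isPreirreducible_of_isOpen hZ (hΩ.preimage hπ) hne
  refine closure_minimal ?_ isClosed_closure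
  calc π '' Z ⊆ π '' closure (Z ∩ π ⁻¹' Ω) := image_mono hdense
    _ ⊆ closure (π '' (Z ∩ π ⁻¹' Ω)) := image_closure_subset_closure_image hπ

/-- **A closed irreducible subset of `S` whose preimage under an open embedding is a component of the preimage of `S` is a component
of `S`** (it meets the range; its dense open part is shared with the component of `S` that pulls back to the same set).
[folklore] -/
theorem mem_componentsIn_of_preimage_mem {f : X → Y} (hf : IsOpenEmbedding f) {S E : Set Y} (hES : E ⊆ S)
    (hEirr : IsIrreducible E) (hEcl : IsClosed E) (hne : (E ∩ range f).Nonempty)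
    (hpre : f ⁻¹' E ∈ componentsIn (f ⁻¹' S)) : E ∈ componentsIn S := by
  -- the component `E₂` of `S` pulling back to `f ⁻¹' E`
  obtain ⟨E₂, hE₂, hne₂, heq⟩ := exists_mem_componentsIn_preimage_eq hf hpre
  -- the common dense open part `B = E ∩ range f = E₂ ∩ range f`
  have hcap : E₂ ∩ range f = E ∩ range f := by
    rw [← image_preimage_eq_inter_range, ← image_preimage_eq_inter_range, heq]
  have hBirr : IsIrreducible (E ∩ range f) := by
    rw [← image_preimage_eq_inter_range]
    exact (componentsIn.isIrreducible hpre).image f hf.continuous.continuousOn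
  have hEB : E ⊆ closure (E ∩ range f) :=
    subset_closure_inter_of_isPreirreducible_of_isOpen hEirr.2 hf.isOpen_range hne
  have hE₂B : E₂ ⊆ closure (E ∩ range f) := by
    rw [← hcap]
    exact subset_closure_inter_of_isPreirreducible_of_isOpen (componentsIn.isIrreducible hE₂).2 hf.isOpen_range hne₂
  -- `W = E ∪ E₂` is irreducible (sandwiched over `B`), inside `S`, hence inside the component `E₂`
  have hWirr : IsIrreducible (E ∪ E₂) :=
    ⟨hEirr.1.mono subset_union_left,
      IsPreirreducible.of_subset_of_subset_closure hBirr.2 (inter_subset_left.trans subset_union_left)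
        (union_subset hEB hE₂B)⟩
  have hWE₂ : E ∪ E₂ ⊆ E₂ :=
    (mem_componentsIn_iff.mp hE₂).2.2 _ (union_subset hES (componentsIn.subset hE₂)) hWirr subset_union_right
  have hEE₂ : E = E₂ := by
    refine Subset.antisymm (subset_union_left.trans hWE₂) ?_
    exact hE₂B.trans ((closure_mono inter_subset_left).trans hEcl.closure_subset)
  rw [hEE₂]
  exact hE₂


/-! ### A square of maps over an open embedding: `πβ ∘ f' = f ∘ πα`, `range f' = πβ ⁻¹' (range f)` -/

section Square

variable {X' : Type u} {Y' : Type v} [TopologicalSpace X'] [TopologicalSpace Y']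
  {f : X → Y} {f' : X' → Y'} {πα : X' → X} {πβ : Y' → Y}

omit [TopologicalSpace X] [TopologicalSpace Y] [TopologicalSpace X'] [TopologicalSpace Y'] in
/-- **`πα '' (f' ⁻¹' Z') = f ⁻¹' (πβ '' Z')`** for a commuting square `πβ ∘ f' = f ∘ πα` with `f` injective and
`range f' = πβ ⁻¹' (range f)`. [folklore] -/
theorem image_preimage_eq_preimage_image_of_range_eq (hf : Function.Injective f) (hsq : ∀ x', πβ (f' x') = f (πα x'))
    (hrange : range f' = πβ ⁻¹' range f) (Z' : Set Y') : πα '' (f' ⁻¹' Z') = f ⁻¹' (πβ '' Z') := by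
  refine Subset.antisymm ?_ ?_
  · rintro _ ⟨x', hx', rfl⟩
    exact ⟨f' x', hx', hsq x'⟩
  · rintro x ⟨z', hz', hz'x⟩
    have hz'r : z' ∈ range f' := by
      rw [hrange]
      exact ⟨x, hz'x.symm⟩
    obtain ⟨x', rfl⟩ := hz'r
    refine ⟨x', hz', hf ?_⟩
    rw [← hsq x', hz'x]

omit [TopologicalSpace X'] [TopologicalSpace Y'] in
/-- **`closure (πα '' (f' ⁻¹' Z')) = f ⁻¹' closure (πβ '' Z')`** for such a square with `f` an open embedding (open maps pull
closures back to closures). [folklore] -/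
theorem closure_image_preimage_eq_preimage_closure_image (hf : IsOpenEmbedding f)
    (hsq : ∀ x', πβ (f' x') = f (πα x')) (hrange : range f' = πβ ⁻¹' range f) (Z' : Set Y') :
    closure (πα '' (f' ⁻¹' Z')) = f ⁻¹' closure (πβ '' Z') := by
  rw [image_preimage_eq_preimage_image_of_range_eq hf.injective hsq hrange,
    hf.isOpenMap.preimage_closure_eq_closure_preimage hf.continuous]

omit [TopologicalSpace X'] in
/-- **The dominance tests agree** across such a square with `f` an open embedding: for `S` closed and `Z'` preirreducible with
`f' ⁻¹' Z' ≠ ∅`, `closure (πα '' (f' ⁻¹' Z'))` is a component of `f ⁻¹' S` iff `closure (πβ '' Z')` is a component of `S`.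
[folklore] -/
theorem closure_image_preimage_mem_componentsIn_iff (hf : IsOpenEmbedding f) (hπβ : Continuous πβ)
    (hsq : ∀ x', πβ (f' x') = f (πα x')) (hrange : range f' = πβ ⁻¹' range f) {S : Set Y} (hS : IsClosed S)
    {Z' : Set Y'} (hZ' : IsPreirreducible Z') (hne : (f' ⁻¹' Z').Nonempty) :
    closure (πα '' (f' ⁻¹' Z')) ∈ componentsIn (f ⁻¹' S) ↔ closure (πβ '' Z') ∈ componentsIn S := by
  rw [closure_image_preimage_eq_preimage_closure_image hf hsq hrange]
  -- `E = closure (πβ '' Z')` is closed, irreducible and meets `range f`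
  obtain ⟨x', hx'⟩ := hne
  have hEirr : IsIrreducible (closure (πβ '' Z')) :=
    IsIrreducible.closure ⟨⟨πβ (f' x'), f' x', hx', rfl⟩, (hZ'.image πβ hπβ.continuousOn)⟩
  have hEne : (closure (πβ '' Z') ∩ range f).Nonempty :=
    ⟨πβ (f' x'), subset_closure ⟨f' x', hx', rfl⟩, by rw [hsq]; exact ⟨πα x', rfl⟩⟩
  refine ⟨fun h => ?_, fun h => preimage_mem_componentsIn_of_isOpenEmbedding hf h hEne⟩
  -- `E ⊆ S`: its dense open part `E ∩ range f = f '' (f ⁻¹' E) ⊆ f '' (f ⁻¹' S) ⊆ S`, `S` closed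
  have hES : closure (πβ '' Z') ⊆ S := by
    have h1 : closure (πβ '' Z') ⊆ closure (closure (πβ '' Z') ∩ range f) :=
      subset_closure_inter_of_isPreirreducible_of_isOpen hEirr.2 hf.isOpen_range hEne
    have h2 : closure (πβ '' Z') ∩ range f ⊆ S := by
      rw [← image_preimage_eq_inter_range]
      exact image_subset_iff.mpr (componentsIn.subset h)
    exact h1.trans ((closure_mono h2).trans hS.closure_subset)
  exact mem_componentsIn_of_preimage_mem hf hES hEirr isClosed_closure hEne h

end Square

/-! ### The idle case: no blow-up on the open, `πβ ∘ f' = f` -/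

/-- **A component over the open dominates its shadow** when the open is not blown up: for open embeddings `f : X → Y`,
`f' : X → Y'` with `πβ ∘ f' = f`, `S ⊆ Y` closed, `S' ⊆ Y'` with `f' ⁻¹' S' = f ⁻¹' S`, and a component `Z'` of `S'` meeting
`range f'`, there is a component `Z` of `S` meeting `range f` with `f ⁻¹' Z = f' ⁻¹' Z'` and `closure (πβ '' Z') = Z`. [folklore] -/
theorem exists_eq_closure_image_of_comp_eq {Y' : Type v} [TopologicalSpace Y']
    {f : X → Y} {f' : X → Y'} {πβ : Y' → Y} (hf : IsOpenEmbedding f) (hf' : IsOpenEmbedding f') (hπβ : Continuous πβ)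
    (hsq : ∀ x, πβ (f' x) = f x) {S : Set Y} (hS : IsClosed S) {S' : Set Y'} (hSS' : f' ⁻¹' S' = f ⁻¹' S)
    {Z' : Set Y'} (hZ' : Z' ∈ componentsIn S') (hne : (Z' ∩ range f').Nonempty) :
    ∃ Z ∈ componentsIn S, (Z ∩ range f).Nonempty ∧ f ⁻¹' Z = f' ⁻¹' Z' ∧ closure (πβ '' Z') = Z := by
  -- the trace `f' ⁻¹' Z'` is a component of `f' ⁻¹' S' = f ⁻¹' S`, hence the trace of a component `Z` of `S`
  have htr : f' ⁻¹' Z' ∈ componentsIn (f ⁻¹' S) := hSS' ▸ preimage_mem_componentsIn_of_isOpenEmbedding hf' hZ' hne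
  obtain ⟨Z, hZ, hZne, hZeq⟩ := exists_mem_componentsIn_preimage_eq hf htr
  refine ⟨Z, hZ, hZne, hZeq, ?_⟩
  have hZcl : IsClosed Z := componentsIn.isClosed hS hZ
  have hZ'irr := componentsIn.isIrreducible hZ'
  -- `πβ '' (Z' ∩ range f') = Z ∩ range f`
  have himg : πβ '' (Z' ∩ range f') = Z ∩ range f := by
    rw [← image_preimage_eq_inter_range, ← image_preimage_eq_inter_range, hZeq, image_image]
    exact image_congr fun x _ => hsq x
  refine Subset.antisymm ?_ ?_
  · -- `πβ '' Z' ⊆ closure (πβ '' (Z' ∩ range f')) = closure (Z ∩ range f) ⊆ Z`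
    refine closure_minimal ?_ hZcl
    have hd : Z' ⊆ closure (Z' ∩ range f') :=
      subset_closure_inter_of_isPreirreducible_of_isOpen hZ'irr.2 hf'.isOpen_range hne
    calc πβ '' Z' ⊆ πβ '' closure (Z' ∩ range f') := image_mono hd
      _ ⊆ closure (πβ '' (Z' ∩ range f')) := image_closure_subset_closure_image hπβ
      _ ⊆ Z := by rw [himg]; exact closure_minimal inter_subset_left hZcl
  · -- `Z ⊆ closure (Z ∩ range f) ⊆ closure (πβ '' Z')`
    calc Z ⊆ closure (Z ∩ range f) :=
          subset_closure_inter_of_isPreirreducible_of_isOpen (componentsIn.isIrreducible hZ).2 hf.isOpen_range hZne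
      _ ⊆ closure (πβ '' Z') := by rw [← himg]; exact closure_mono (image_mono inter_subset_left)

end Summit.ResolutionOfSingularities.ResolutionOfSingularities.Theorems.CampaignW42

/-! ## §B. The label order relation between a stage and its pointed open -/

namespace Summit.ResolutionOfSingularities.ResolutionOfSingularities.Cruxes.SigmaMaxModifications.IdeasL1Idea2R4

open CategoryTheory AlgebraicGeometry
open Literature.AlgebraicGeometry.Resolution
open Summit.ResolutionOfSingularities.ResolutionOfSingularities.Theorems.CampaignW42

variable {V W : Scheme.{u}}

/-- [OURS · D8-S1] **THE LABEL ORDER RELATION** between the bookkeeping `L` of a stage `W` and the bookkeeping `L'` of an open `V`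
of it (`ι : V ⟶ W` an open immersion), relative to the stratum `Y ⊆ W`: on the irreducible components of `Y` MEETING the range of
`ι`, the label order of `L` is the label order of `L'` on their traces `ι⁻¹ Z` (the components of `ι⁻¹ Y`). Only the order and
the equality of labels are read by the canonical step (least non-empty label, parts), so this is what the run-level localisation
transports. OURS bookkeeping; NOT a statement of the manuscript. [folklore] -/
def LabelRel (ι : V ⟶ W) (Y : Set W) (L : Labelling W) (L' : Labelling V) : Prop :=
  ∀ ⦃Z₁ : Set W⦄, Z₁ ∈ componentsIn Y → (Z₁ ∩ Set.range ι.base).Nonempty →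
    ∀ ⦃Z₂ : Set W⦄, Z₂ ∈ componentsIn Y → (Z₂ ∩ Set.range ι.base).Nonempty →
      (L.label Z₁ ≤ L.label Z₂ ↔ L'.label (ι.base ⁻¹' Z₁) ≤ L'.label (ι.base ⁻¹' Z₂))

namespace LabelRel

variable {ι : V ⟶ W} {Y : Set W} {L : Labelling W} {L' : Labelling V}

/-- Equality of labels is reflected too. [folklore] -/
theorem label_eq_iff (h : LabelRel ι Y L L') {Z₁ : Set W} (hZ₁ : Z₁ ∈ componentsIn Y)
    (hne₁ : (Z₁ ∩ Set.range ι.base).Nonempty) {Z₂ : Set W} (hZ₂ : Z₂ ∈ componentsIn Y)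
    (hne₂ : (Z₂ ∩ Set.range ι.base).Nonempty) :
    L.label Z₁ = L.label Z₂ ↔ L'.label (ι.base ⁻¹' Z₁) = L'.label (ι.base ⁻¹' Z₂) := by
  rw [le_antisymm_iff, le_antisymm_iff, h hZ₁ hne₁ hZ₂ hne₂, h hZ₂ hne₂ hZ₁ hne₁]

/-- **The trivial start**: if any two components of `Y` meeting the range of `ι` are equal (e.g. the open is POINTED:
`ι⁻¹ Y = {y}`), the relation holds for every pair of bookkeepings. [folklore] -/
theorem of_forall_eq (h : ∀ ⦃Z₁ : Set W⦄, Z₁ ∈ componentsIn Y → (Z₁ ∩ Set.range ι.base).Nonempty →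
      ∀ ⦃Z₂ : Set W⦄, Z₂ ∈ componentsIn Y → (Z₂ ∩ Set.range ι.base).Nonempty → Z₁ = Z₂)
    (L : Labelling W) (L' : Labelling V) : LabelRel ι Y L L' := by
  intro Z₁ hZ₁ hne₁ Z₂ hZ₂ hne₂
  rw [h hZ₁ hne₁ hZ₂ hne₂]
  exact ⟨fun _ => le_rfl, fun _ => le_rfl⟩

variable [IsOpenImmersion ι]

/-- **Parts pull back to parts**: the trace of the part `Y^{(i)}`, `i` the label of a component `Z₀` meeting the range, is the part
of `ι⁻¹ Y` with the label of the trace of `Z₀`. [folklore] -/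
theorem preimage_part_eq (h : LabelRel ι Y L L') {Z₀ : Set W} (hZ₀ : Z₀ ∈ componentsIn Y)
    (hne₀ : (Z₀ ∩ Set.range ι.base).Nonempty) :
    ι.base ⁻¹' L.part Y (L.label Z₀) = L'.part (ι.base ⁻¹' Y) (L'.label (ι.base ⁻¹' Z₀)) := by
  ext v
  rw [Set.mem_preimage, Labelling.mem_part_iff, Labelling.mem_part_iff]
  constructor
  · rintro ⟨Z, hZ, hl, hvZ⟩
    have hne : (Z ∩ Set.range ι.base).Nonempty := ⟨ι.base v, hvZ, v, rfl⟩
    exact ⟨ι.base ⁻¹' Z, preimage_mem_componentsIn_of_isOpenEmbedding ι.isOpenEmbedding hZ hne,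
      (h.label_eq_iff hZ hne hZ₀ hne₀).mp hl, hvZ⟩
  · rintro ⟨Z', hZ', hl, hvZ'⟩
    obtain ⟨Z, hZ, hne, rfl⟩ := exists_mem_componentsIn_preimage_eq ι.isOpenEmbedding hZ'
    exact ⟨Z, hZ, (h.label_eq_iff hZ hne hZ₀ hne₀).mpr hl, hvZ'⟩

/-- **The least non-empty label pulls back to the least non-empty label**, when the least non-empty part meets the range (at a
component `Z₀`). [folklore] -/
theorem isLeast (h : LabelRel ι Y L L') {j : ℕ} (hj : IsLeast {i | (L.part Y i).Nonempty} j) {Z₀ : Set W}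
    (hZ₀ : Z₀ ∈ componentsIn Y) (hl₀ : L.label Z₀ = j) (hne₀ : (Z₀ ∩ Set.range ι.base).Nonempty) :
    IsLeast {i | (L'.part (ι.base ⁻¹' Y) i).Nonempty} (L'.label (ι.base ⁻¹' Z₀)) := by
  constructor
  · obtain ⟨_, hwZ, v, rfl⟩ := hne₀
    refine ⟨v, (Labelling.mem_part_iff _ _ _ _).mpr ⟨ι.base ⁻¹' Z₀,
      preimage_mem_componentsIn_of_isOpenEmbedding ι.isOpenEmbedding hZ₀ ⟨_, hwZ, v, rfl⟩, rfl, hwZ⟩⟩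
  · rintro i ⟨v, hv⟩
    obtain ⟨Z', hZ', hl, hvZ'⟩ := (Labelling.mem_part_iff _ _ _ _).mp hv
    obtain ⟨Z, hZ, hne, rfl⟩ := exists_mem_componentsIn_preimage_eq ι.isOpenEmbedding hZ'
    have hjZ : j ≤ L.label Z := hj.2 ⟨ι.base v, (Labelling.mem_part_iff _ _ _ _).mpr ⟨Z, hZ, rfl, hvZ'⟩⟩
    rw [← hl]
    exact (h hZ₀ hne₀ hZ hne).mp (hl₀ ▸ hjZ)

omit [IsOpenImmersion ι] in
/-- **PROPAGATION THROUGH A GENUINE STEP ON THE OPEN**: if the open is blown up along `C'` compatibly (`ι' : Bl_{C'} V ⟶ Bl_C W` an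
open immersion over `ι` with range `π_C⁻¹(range ι)`), labels are `≤` the years and `Y` is closed, then the updated bookkeepings
`L.next Y C`, `L'.next (ι⁻¹ Y) C'` are again related along `ι'`, for every new stratum `Y'`: the dominance tests agree
(`closure_image_preimage_mem_componentsIn_iff`), inherited labels compare as before, new labels are the new years on both sides.
[cite: CossartJannsenSaito2020, Rem. 6.29 (1)] -/
theorem next_next [IsOpenImmersion ι] (h : LabelRel ι Y L L') (hY : IsClosed Y) (hL : ∀ Z, L.label Z ≤ L.year)
    (hL' : ∀ Z, L'.label Z ≤ L'.year) (C : W.IdealSheafData) (C' : V.IdealSheafData)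
    (ι' : blowup C' ⟶ blowup C) [IsOpenImmersion ι'] (hι' : ι' ≫ blowup.π C = blowup.π C' ≫ ι)
    (hrange : Set.range ι'.base = (blowup.π C).base ⁻¹' Set.range ι.base) (Y' : Set ↥(blowup C)) :
    LabelRel ι' Y' (L.next Y C) (L'.next (ι.base ⁻¹' Y) C') := by
  have hsq : ∀ x', (blowup.π C).base (ι'.base x') = ι.base ((blowup.π C').base x') := fun x' => by
    rw [← Scheme.Hom.comp_apply, hι', Scheme.Hom.comp_apply]
  -- the test on the open, rewritten through the square
  have htest : ∀ {Z' : Set ↥(blowup C)}, Z' ∈ componentsIn Y' → (Z' ∩ Set.range ι'.base).Nonempty →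
      closure ((blowup.π C').base '' (ι'.base ⁻¹' Z')) = ι.base ⁻¹' closure ((blowup.π C).base '' Z') ∧
      (closure ((blowup.π C').base '' (ι'.base ⁻¹' Z')) ∈ componentsIn (ι.base ⁻¹' Y) ↔
        closure ((blowup.π C).base '' Z') ∈ componentsIn Y) ∧
      (closure ((blowup.π C).base '' Z') ∩ Set.range ι.base).Nonempty := by
    intro Z' hZ' hne
    obtain ⟨_, hzZ, x', rfl⟩ := hne
    refine ⟨closure_image_preimage_eq_preimage_closure_image ι.isOpenEmbedding hsq hrange Z',
      closure_image_preimage_mem_componentsIn_iff ι.isOpenEmbedding (blowup.π C).continuous hsq hrange hY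
        (componentsIn.isIrreducible hZ').2 ⟨x', hzZ⟩,
      ⟨_, subset_closure ⟨_, hzZ, rfl⟩, by rw [hsq]; exact ⟨_, rfl⟩⟩⟩
  intro Z₁ hZ₁ hne₁ Z₂ hZ₂ hne₂
  obtain ⟨he₁, ht₁, hm₁⟩ := htest hZ₁ hne₁
  obtain ⟨he₂, ht₂, hm₂⟩ := htest hZ₂ hne₂
  by_cases h₁ : closure ((blowup.π C).base '' Z₁) ∈ componentsIn Y <;>
    by_cases h₂ : closure ((blowup.π C).base '' Z₂) ∈ componentsIn Y
  · rw [Labelling.next_label_of_mem L C h₁, Labelling.next_label_of_mem L C h₂,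
      Labelling.next_label_of_mem L' C' (ht₁.mpr h₁), Labelling.next_label_of_mem L' C' (ht₂.mpr h₂), he₁, he₂]
    exact h h₁ hm₁ h₂ hm₂
  · rw [Labelling.next_label_of_mem L C h₁, Labelling.next_label_of_not_mem L C h₂,
      Labelling.next_label_of_mem L' C' (ht₁.mpr h₁), Labelling.next_label_of_not_mem L' C' (mt ht₂.mp h₂)]
    exact ⟨fun _ => (hL' _).trans (Nat.le_succ _), fun _ => (hL _).trans (Nat.le_succ _)⟩
  · rw [Labelling.next_label_of_not_mem L C h₁, Labelling.next_label_of_mem L C h₂,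
      Labelling.next_label_of_not_mem L' C' (mt ht₁.mp h₁), Labelling.next_label_of_mem L' C' (ht₂.mpr h₂)]
    exact ⟨fun hle => absurd (hle.trans (hL _)) (Nat.not_succ_le_self _),
      fun hle => absurd (hle.trans (hL' _)) (Nat.not_succ_le_self _)⟩
  · rw [Labelling.next_label_of_not_mem L C h₁, Labelling.next_label_of_not_mem L C h₂,
      Labelling.next_label_of_not_mem L' C' (mt ht₁.mp h₁), Labelling.next_label_of_not_mem L' C' (mt ht₂.mp h₂)]
    exact ⟨fun _ => le_rfl, fun _ => le_rfl⟩

omit [IsOpenImmersion ι] in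
/-- **PROPAGATION THROUGH AN IDLE STEP ON THE OPEN**: if the open is NOT blown up and lifts into the blow-up (`ι' : V ⟶ Bl_C W` an
open immersion with `ι' ≫ π_C = ι`), `Y` is closed and the new stratum has the same trace (`ι'⁻¹ Y' = ι⁻¹ Y`), then every component
of `Y'` meeting the range of `ι'` dominates (`exists_eq_closure_image_of_comp_eq`) and `L.next Y C` is related to the SAME `L'` along
`ι'`. [cite: CossartJannsenSaito2020, Rem. 6.29 (1)] -/
theorem next_left [IsOpenImmersion ι] (h : LabelRel ι Y L L') (hY : IsClosed Y) (C : W.IdealSheafData)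
    (ι' : V ⟶ blowup C) [IsOpenImmersion ι'] (hι' : ι' ≫ blowup.π C = ι) {Y' : Set ↥(blowup C)}
    (hYY' : ι'.base ⁻¹' Y' = ι.base ⁻¹' Y) : LabelRel ι' Y' (L.next Y C) L' := by
  have hsq : ∀ x, (blowup.π C).base (ι'.base x) = ι.base x := fun x => by
    rw [← Scheme.Hom.comp_apply, hι']
  have key : ∀ {Z' : Set ↥(blowup C)}, Z' ∈ componentsIn Y' → (Z' ∩ Set.range ι'.base).Nonempty →
      ∃ Z ∈ componentsIn Y, (Z ∩ Set.range ι.base).Nonempty ∧ ι.base ⁻¹' Z = ι'.base ⁻¹' Z' ∧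
        (L.next Y C).label Z' = L.label Z := by
    intro Z' hZ' hne
    obtain ⟨Z, hZ, hZne, hZeq, hcl⟩ :=
      exists_eq_closure_image_of_comp_eq ι.isOpenEmbedding ι'.isOpenEmbedding (blowup.π C).continuous hsq hY hYY' hZ' hne
    refine ⟨Z, hZ, hZne, hZeq, ?_⟩
    rw [Labelling.next_label_of_mem L C (hcl.symm ▸ hZ), hcl]
  intro Z₁ hZ₁ hne₁ Z₂ hZ₂ hne₂
  obtain ⟨T₁, hT₁, hn₁, he₁, hl₁⟩ := key hZ₁ hne₁
  obtain ⟨T₂, hT₂, hn₂, he₂, hl₂⟩ := key hZ₂ hne₂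
  rw [hl₁, hl₂, ← he₁, ← he₂]
  exact h hT₁ hn₁ hT₂ hn₂

end LabelRel

end Summit.ResolutionOfSingularities.ResolutionOfSingularities.Cruxes.SigmaMaxModifications.IdeasL1Idea2R4
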